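import Literature.AlgebraicGeometry.Frobenioids.ModelFrobenioidDivision
import HarnessLib

/-!
# Frobenioids I, Theorem 5.2 (ii), first sentence — part 3: clause (iii) of Definition 1.3 for the
# model Frobenioid (abc-iut cell, layer L1, node F-D1a)

Mochizuki, *The geometry of Frobenioids I: the general theory*, Kyushu J. Math. **62** (2008)
293–400, §5, Theorem 5.2 (ii), kurims text p. 101 [cite: MochizukiFrdI2008, Thm. 5.2(ii) p.101]
("a routine verification … reminiscent of … Proposition 1.5, (i)").

Def. 1.3 (iii) for `C → F_Φ` (`C = ModelFrobenioid Φ B DivB`): (a), (b) every arrow is co-angular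
(part 1); (c) a co-angular pre-step `φ : A → B` transports the base-identity linear endomorphisms
`(1, id, y, v)` of `A` (relation (d): `y = Div_B(v)`) to those of `B` along `Base(φ)`, compatibly
with `φ`, and the matching depends only on `Base(φ)`; (d) the four full / essentially-surjective
clauses for `C^coa-pre` under and over `A` versus `Order(Φ(A))`. Parts 1–2:
`ModelFrobenioidPreFrobenioid.lean`, `ModelFrobenioidPullbacks.lean`, `ModelFrobenioidDivision.lean`;
part 4: `ModelFrobenioidIsFrobenioid.lean`. No statement of the paper is strengthened.
-/

noncomputable section

namespace Literature.AlgebraicGeometry.Frobenioids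

namespace ModelFrobenioid

open CategoryTheory Opposite
open PreFrobenioid (pullGp_of' pullGp_inv_pullGp pullGp_pullGp_inv pullGp_injective)

universe w v u

variable {D : Type u} [Category.{v} D] {Φ B : Dᵒᵖ ⥤ CommMonCat.{w}} {DivB : B ⟶ monoidGp Φ}

section Clauses

variable {A Bo B' : ModelFrobenioid Φ B DivB}

/-! ### Definition 1.3 (iii) -/

/-- Transport of a base-identity linear endomorphism `(1, id, y, v)` of `A` along
`g : B_D → A_D`: the endomorphism `(1, id, g^* y, g^* v)` of `Bo` (well defined since relation (d)
for such an endomorphism reads `y = Div_B(v)`). [cite: MochizukiFrdI2008, Thm. 5.2(ii) p.101] -/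
def endTransport (A Bo : ModelFrobenioid Φ B DivB) (g : Bo.base ⟶ A.base)
    (α : PreFrobenioid.endSubmonoid (toElem Φ B DivB) A) :
    PreFrobenioid.endSubmonoid (toElem Φ B DivB) Bo :=
  ⟨mkHom Bo Bo 1 (𝟙 _) (pull Φ g (div (show A ⟶ A from α.1))) (pull B g (unit (show A ⟶ A from α.1)))
    (by
      have hb : baseMap (show A ⟶ A from α.1) = 𝟙 A.base := α.2.1
      have hd : degFr (show A ⟶ A from α.1) = 1 := α.2.2
      have h := rel (show A ⟶ A from α.1)
      rw [hd, hb, PNat.one_coe, pow_one, pullGp_id] at h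
      rw [PNat.one_coe, pow_one, pullGp_id, ← pullGp_of', mul_left_cancel h, pullGp_divB_pull]),
    ⟨rfl, rfl⟩⟩

/-- `Div` of the transported endomorphism. [cite: MochizukiFrdI2008, Thm. 5.2(ii) p.101] -/
theorem div_endTransport (A Bo : ModelFrobenioid Φ B DivB) (g : Bo.base ⟶ A.base)
    (α : PreFrobenioid.endSubmonoid (toElem Φ B DivB) A) :
    div (show Bo ⟶ Bo from (endTransport A Bo g α).1) = pull Φ g (div (show A ⟶ A from α.1)) := rfl

/-- `u` of the transported endomorphism. [cite: MochizukiFrdI2008, Thm. 5.2(ii) p.101] -/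
theorem unit_endTransport (A Bo : ModelFrobenioid Φ B DivB) (g : Bo.base ⟶ A.base)
    (α : PreFrobenioid.endSubmonoid (toElem Φ B DivB) A) :
    unit (show Bo ⟶ Bo from (endTransport A Bo g α).1) = pull B g (unit (show A ⟶ A from α.1)) := rfl

/-- `O^▷(A) ≃ O^▷(B)` along an isomorphism `f : A_D ⥲ B_D`: transport along `f⁻¹` and `f`.
[cite: MochizukiFrdI2008, Thm. 5.2(ii) p.101] -/
def endEquivOfIso (A Bo : ModelFrobenioid Φ B DivB) (f : A.base ⟶ Bo.base) [IsIso f] :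
    PreFrobenioid.endSubmonoid (toElem Φ B DivB) A ≃* PreFrobenioid.endSubmonoid (toElem Φ B DivB) Bo where
  toFun := endTransport A Bo (inv f)
  invFun := endTransport Bo A f
  left_inv α := Subtype.ext (hom_ext α.2.2.symm α.2.1.symm
    (by
      show pull Φ f (pull Φ (inv f) (div (show A ⟶ A from α.1))) = div (show A ⟶ A from α.1)
      rw [← pull_comp, IsIso.hom_inv_id, pull_id])
    (by
      show pull B f (pull B (inv f) (unit (show A ⟶ A from α.1))) = unit (show A ⟶ A from α.1)
      rw [← pull_comp, IsIso.hom_inv_id, pull_id]))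
  right_inv β := Subtype.ext (hom_ext β.2.2.symm β.2.1.symm
    (by
      show pull Φ (inv f) (pull Φ f (div (show Bo ⟶ Bo from β.1))) = div (show Bo ⟶ Bo from β.1)
      rw [← pull_comp, IsIso.inv_hom_id, pull_id])
    (by
      show pull B (inv f) (pull B f (unit (show Bo ⟶ Bo from β.1))) = unit (show Bo ⟶ Bo from β.1)
      rw [← pull_comp, IsIso.inv_hom_id, pull_id]))
  map_mul' α β := by
    have hαd : degFr (show A ⟶ A from α.1) = 1 := α.2.2
    have hβb : baseMap (show A ⟶ A from β.1) = 𝟙 A.base := β.2.1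
    refine Subtype.ext (hom_ext (mul_one _).symm (Category.comp_id _).symm ?_ ?_)
    · show pull Φ (inv f) (pull Φ (baseMap (show A ⟶ A from β.1)) (div (show A ⟶ A from α.1)) *
          div (show A ⟶ A from β.1) ^ (degFr (show A ⟶ A from α.1) : ℕ)) =
        pull Φ (𝟙 Bo.base) (pull Φ (inv f) (div (show A ⟶ A from α.1))) *
          pull Φ (inv f) (div (show A ⟶ A from β.1)) ^ ((1 : ℕ+) : ℕ)
      rw [hβb, pull_id, hαd, PNat.one_coe, pow_one, pow_one, pull_id, map_mul]
    · show pull B (inv f) (pull B (baseMap (show A ⟶ A from β.1)) (unit (show A ⟶ A from α.1)) *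
          unit (show A ⟶ A from β.1) ^ (degFr (show A ⟶ A from α.1) : ℕ)) =
        pull B (𝟙 Bo.base) (pull B (inv f) (unit (show A ⟶ A from α.1))) *
          pull B (inv f) (unit (show A ⟶ A from β.1)) ^ ((1 : ℕ+) : ℕ)
      rw [hβb, pull_id, hαd, PNat.one_coe, pow_one, pow_one, pull_id, map_mul]

/-- Def. 1.3 (iii)(c): a co-angular pre-step `φ : A → B` induces `O^▷(A) ≃ O^▷(B)` compatible with
`φ`. [cite: MochizukiFrdI2008, Thm. 5.2(ii) p.101] -/
theorem iii_c (φ : A ⟶ Bo) (h : PreFrobenioid.IsCoAngularPreStep (toElem Φ B DivB) φ) :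
    ∃ e : PreFrobenioid.endSubmonoid (toElem Φ B DivB) A ≃* PreFrobenioid.endSubmonoid (toElem Φ B DivB) Bo,
      ∀ α : PreFrobenioid.endSubmonoid (toElem Φ B DivB) A,
        φ ≫ (show Bo ⟶ Bo from (e α).1) = (show A ⟶ A from α.1) ≫ φ := by
  haveI : IsIso (baseMap φ) := h.2.2
  have hφ1 : degFr φ = 1 := h.2.1
  refine ⟨endEquivOfIso A Bo (baseMap φ), fun α => ?_⟩
  have hαb : baseMap (show A ⟶ A from α.1) = 𝟙 A.base := α.2.1
  have hαd : degFr (show A ⟶ A from α.1) = 1 := α.2.2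
  refine hom_ext ?_ ?_ ?_ ?_
  · show 1 * degFr φ = degFr φ * degFr (show A ⟶ A from α.1)
    rw [hαd, one_mul, mul_one]
  · show baseMap φ ≫ 𝟙 Bo.base = baseMap (show A ⟶ A from α.1) ≫ baseMap φ
    rw [hαb, Category.comp_id, Category.id_comp]
  · show pull Φ (baseMap φ) (pull Φ (inv (baseMap φ)) (div (show A ⟶ A from α.1))) *
        div φ ^ ((1 : ℕ+) : ℕ) =
      pull Φ (baseMap (show A ⟶ A from α.1)) (div φ) * div (show A ⟶ A from α.1) ^ (degFr φ : ℕ)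
    rw [← pull_comp, IsIso.hom_inv_id, pull_id, hαb, pull_id, hφ1, PNat.one_coe, pow_one, pow_one,
      mul_comm]
  · show pull B (baseMap φ) (pull B (inv (baseMap φ)) (unit (show A ⟶ A from α.1))) *
        unit φ ^ ((1 : ℕ+) : ℕ) =
      pull B (baseMap (show A ⟶ A from α.1)) (unit φ) * unit (show A ⟶ A from α.1) ^ (degFr φ : ℕ)
    rw [← pull_comp, IsIso.hom_inv_id, pull_id, hαb, pull_id, hφ1, PNat.one_coe, pow_one, pow_one,
      mul_comm]

/-- Def. 1.3 (iii)(c), dependence on `Base(φ)` only: the `β` matched to `α` is determined by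
`Base(φ)` (injectivity of `Base(φ)^*` on `Φ` and `B`, cancellation). [cite: MochizukiFrdI2008, Thm. 5.2(ii) p.101] -/
theorem iii_c_base (hΦ : IsMonoidOn Φ) (hΦd : Objectwise (fun M _ => IsDivisorial M) Φ)
    (hB : IsMonoidOn B) (hBg : Objectwise (fun M _ => IsGroupLike M) B) (φ φ' : A ⟶ Bo)
    (h : PreFrobenioid.IsCoAngularPreStep (toElem Φ B DivB) φ)
    (h' : PreFrobenioid.IsCoAngularPreStep (toElem Φ B DivB) φ')
    (hb : PreFrobenioid.Base (toElem Φ B DivB) φ = PreFrobenioid.Base (toElem Φ B DivB) φ')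
    (α : PreFrobenioid.endSubmonoid (toElem Φ B DivB) A)
    (β β' : PreFrobenioid.endSubmonoid (toElem Φ B DivB) Bo)
    (e₁ : φ ≫ (show Bo ⟶ Bo from β.1) = (show A ⟶ A from α.1) ≫ φ)
    (e₂ : φ' ≫ (show Bo ⟶ Bo from β'.1) = (show A ⟶ A from α.1) ≫ φ') : β = β' := by
  haveI : IsCancelMul (Φ.obj (op A.base)) :=
    isIntegral_iff_isCancelMul.mp (hΦd A.base).isPreDivisorial.isIntegral
  haveI : IsCancelMul (B.obj (op A.base)) :=
    isIntegral_iff_isCancelMul.mp (hBg A.base).isPreDivisorial.isIntegral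
  have hb' : baseMap φ = baseMap φ' := hb
  have hφ1 : degFr φ = 1 := h.2.1
  have hφ1' : degFr φ' = 1 := h'.2.1
  have hαb : baseMap (show A ⟶ A from α.1) = 𝟙 A.base := α.2.1
  have hβb : baseMap (show Bo ⟶ Bo from β.1) = 𝟙 Bo.base := β.2.1
  have hβb' : baseMap (show Bo ⟶ Bo from β'.1) = 𝟙 Bo.base := β'.2.1
  have hβd : degFr (show Bo ⟶ Bo from β.1) = 1 := β.2.2
  have hβd' : degFr (show Bo ⟶ Bo from β'.1) = 1 := β'.2.2
  have d₁ : pull Φ (baseMap φ) (div (show Bo ⟶ Bo from β.1)) * div φ ^ (degFr (show Bo ⟶ Bo from β.1) : ℕ) =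
      pull Φ (baseMap (show A ⟶ A from α.1)) (div φ) * div (show A ⟶ A from α.1) ^ (degFr φ : ℕ) :=
    congrArg Hom.div e₁
  have d₂ : pull Φ (baseMap φ') (div (show Bo ⟶ Bo from β'.1)) * div φ' ^ (degFr (show Bo ⟶ Bo from β'.1) : ℕ) =
      pull Φ (baseMap (show A ⟶ A from α.1)) (div φ') * div (show A ⟶ A from α.1) ^ (degFr φ' : ℕ) :=
    congrArg Hom.div e₂
  have u₁ : pull B (baseMap φ) (unit (show Bo ⟶ Bo from β.1)) * unit φ ^ (degFr (show Bo ⟶ Bo from β.1) : ℕ) =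
      pull B (baseMap (show A ⟶ A from α.1)) (unit φ) * unit (show A ⟶ A from α.1) ^ (degFr φ : ℕ) :=
    congrArg Hom.unit e₁
  have u₂ : pull B (baseMap φ') (unit (show Bo ⟶ Bo from β'.1)) * unit φ' ^ (degFr (show Bo ⟶ Bo from β'.1) : ℕ) =
      pull B (baseMap (show A ⟶ A from α.1)) (unit φ') * unit (show A ⟶ A from α.1) ^ (degFr φ' : ℕ) :=
    congrArg Hom.unit e₂
  rw [hβd, hφ1, PNat.one_coe, pow_one, pow_one, hαb, pull_id, mul_comm] at d₁ u₁
  rw [hβd', hφ1', PNat.one_coe, pow_one, pow_one, hαb, pull_id, mul_comm, ← hb'] at d₂ u₂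
  have kd : div (show Bo ⟶ Bo from β.1) = div (show Bo ⟶ Bo from β'.1) :=
    (hΦ.isCharInjective (baseMap φ)).1 ((mul_left_cancel d₁).trans (mul_left_cancel d₂).symm)
  have ku : unit (show Bo ⟶ Bo from β.1) = unit (show Bo ⟶ Bo from β'.1) :=
    (hB.isCharInjective (baseMap φ)).1 ((mul_left_cancel u₁).trans (mul_left_cancel u₂).symm)
  exact Subtype.ext (hom_ext (hβd.trans hβd'.symm) (hβb.trans hβb'.symm) kd ku)

/-- Def. 1.3 (iii)(d), coslice, fullness: `Div φ ≤ Div φ'` lifts to the co-angular pre-step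
`φ' / φ` under `A`. [cite: MochizukiFrdI2008, Thm. 5.2(ii) p.101] -/
theorem iii_d_under_full (hBg : Objectwise (fun M _ => IsGroupLike M) B) (φ : A ⟶ Bo) (φ' : A ⟶ B')
    (h : PreFrobenioid.IsCoAngularPreStep (toElem Φ B DivB) φ)
    (h' : PreFrobenioid.IsCoAngularPreStep (toElem Φ B DivB) φ')
    (hd : PreFrobenioid.Div (toElem Φ B DivB) φ ∣ PreFrobenioid.Div (toElem Φ B DivB) φ') :
    ∃ f : Bo ⟶ B', PreFrobenioid.IsCoAngularPreStep (toElem Φ B DivB) f ∧ φ ≫ f = φ' := by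
  haveI : IsIso (baseMap φ) := h.2.2
  haveI : IsIso (baseMap φ') := h'.2.2
  have hφ1 : degFr φ = 1 := h.2.1
  have hφ1' : degFr φ' = 1 := h'.2.1
  obtain ⟨z, hz⟩ : div φ ∣ div φ' := hd
  obtain ⟨uu, huu⟩ := (hBg A.base).isUnit (unit φ)
  have e₁ : degFr φ' = 1 * degFr φ := by rw [hφ1, hφ1', mul_one]
  have e₂ : baseMap φ' = baseMap φ ≫ inv (baseMap φ) ≫ baseMap φ' := by rw [IsIso.hom_inv_id_assoc]
  have e₃ : div φ' = pull Φ (baseMap φ) (pull Φ (inv (baseMap φ)) z) * div φ ^ ((1 : ℕ+) : ℕ) := by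
    rw [← pull_comp, IsIso.hom_inv_id, pull_id, PNat.one_coe, pow_one, hz, mul_comm]
  have e₄ : unit φ' = pull B (baseMap φ) (pull B (inv (baseMap φ)) (unit φ' * ↑uu⁻¹)) *
      unit φ ^ ((1 : ℕ+) : ℕ) := by
    rw [← pull_comp, IsIso.hom_inv_id, pull_id, PNat.one_coe, pow_one, ← huu, Units.inv_mul_cancel_right]
  let g : Bo ⟶ B' := divRight φ φ' 1 (inv (baseMap φ) ≫ baseMap φ') (pull Φ (inv (baseMap φ)) z)
    (pull B (inv (baseMap φ)) (unit φ' * ↑uu⁻¹)) e₁ e₂ e₃ e₄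
  exact ⟨g, ⟨isCoAngular hBg _, rfl, show IsIso (inv (baseMap φ) ≫ baseMap φ') from inferInstance⟩,
    comp_divRight φ φ' _ _ _ _ e₁ e₂ e₃ e₄⟩

/-- Def. 1.3 (iii)(d), coslice, essential surjectivity: `x = Div(1, id, x, 0)` with target
`(A_D, α + x)`. [cite: MochizukiFrdI2008, Thm. 5.2(ii) p.101] -/
theorem iii_d_under_surj (hBg : Objectwise (fun M _ => IsGroupLike M) B) (A : ModelFrobenioid Φ B DivB)
    (x : Φ.obj (op (PreFrobenioid.baseObj (toElem Φ B DivB) A))) :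
    ∃ (Bo : ModelFrobenioid Φ B DivB) (φ : A ⟶ Bo),
      PreFrobenioid.IsCoAngularPreStep (toElem Φ B DivB) φ ∧ PreFrobenioid.Div (toElem Φ B DivB) φ = x := by
  let x₀ : Φ.obj (op A.base) := x
  let Bo : ModelFrobenioid Φ B DivB := ⟨A.base, A.cls * Algebra.GrothendieckGroup.of x₀⟩
  refine ⟨Bo, mkHom A Bo 1 (𝟙 _) x₀ 1 ?_,
    ⟨isCoAngular hBg _, rfl, show IsIso (𝟙 A.base) from inferInstance⟩, rfl⟩
  show A.cls ^ ((1 : ℕ+) : ℕ) * Algebra.GrothendieckGroup.of x₀ =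
    pullGp Φ (𝟙 A.base) (A.cls * Algebra.GrothendieckGroup.of x₀) * divB Φ B DivB _ 1
  rw [PNat.one_coe, pow_one, pullGp_id, map_one, mul_one]

/-- Def. 1.3 (iii)(d), slice, fullness: `(ψ'^*)⁻¹ Div ψ' ≤ (ψ^*)⁻¹ Div ψ` lifts to the co-angular
pre-step `ψ'⁻¹ ∘ ψ` over `A`. [cite: MochizukiFrdI2008, Thm. 5.2(ii) p.101] -/
theorem iii_d_over_full (hBg : Objectwise (fun M _ => IsGroupLike M) B) (ψ : Bo ⟶ A) (ψ' : B' ⟶ A)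
    (h : PreFrobenioid.IsCoAngularPreStep (toElem Φ B DivB) ψ)
    (h' : PreFrobenioid.IsCoAngularPreStep (toElem Φ B DivB) ψ')
    (hd : PreFrobenioid.invDiv (toElem Φ B DivB) ψ' h'.2.2 ∣ PreFrobenioid.invDiv (toElem Φ B DivB) ψ h.2.2) :
    ∃ g : Bo ⟶ B', PreFrobenioid.IsCoAngularPreStep (toElem Φ B DivB) g ∧ g ≫ ψ' = ψ := by
  haveI : IsIso (baseMap ψ) := h.2.2
  haveI : IsIso (baseMap ψ') := h'.2.2
  have hψ1 : degFr ψ = 1 := h.2.1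
  have hψ1' : degFr ψ' = 1 := h'.2.1
  obtain ⟨z, hz⟩ : pull Φ (inv (baseMap ψ')) (div ψ') ∣ pull Φ (inv (baseMap ψ)) (div ψ) := hd
  obtain ⟨uu, huu⟩ := (hBg B'.base).isUnit (unit ψ')
  let gb : Bo.base ⟶ B'.base := baseMap ψ ≫ inv (baseMap ψ')
  have e₂ : baseMap ψ = gb ≫ baseMap ψ' := by
    show baseMap ψ = (baseMap ψ ≫ inv (baseMap ψ')) ≫ baseMap ψ'
    rw [Category.assoc, IsIso.inv_hom_id, Category.comp_id]
  have e₃ : div ψ = pull Φ gb (div ψ') * pull Φ (baseMap ψ) z := by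
    show div ψ = pull Φ (baseMap ψ ≫ inv (baseMap ψ')) (div ψ') * pull Φ (baseMap ψ) z
    rw [pull_comp, ← map_mul, ← hz, ← pull_comp, IsIso.hom_inv_id, pull_id]
  have e₄ : unit ψ = pull B gb (unit ψ') * (unit ψ * ↑(Units.map (pull B gb) uu)⁻¹) := by
    rw [mul_comm, mul_assoc, ← huu, ← Units.coe_map, Units.inv_mul, mul_one]
  let g : Bo ⟶ B' := divLeft ψ' hψ1' ψ 1 gb (pull Φ (baseMap ψ) z)
    (unit ψ * ↑(Units.map (pull B gb) uu)⁻¹) hψ1 e₂ e₃ e₄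
  exact ⟨g, ⟨isCoAngular hBg _, rfl, show IsIso (baseMap ψ ≫ inv (baseMap ψ')) from inferInstance⟩,
    divLeft_comp ψ' hψ1' ψ _ _ _ _ hψ1 e₂ e₃ e₄⟩

/-- Def. 1.3 (iii)(d), slice, essential surjectivity: `x = (id^*)⁻¹ Div(1, id, x, 0)` with source
`(A_D, α − x)`. [cite: MochizukiFrdI2008, Thm. 5.2(ii) p.101] -/
theorem iii_d_over_surj (hBg : Objectwise (fun M _ => IsGroupLike M) B) (A : ModelFrobenioid Φ B DivB)
    (x : Φ.obj (op (PreFrobenioid.baseObj (toElem Φ B DivB) A))) :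
    ∃ (Bo : ModelFrobenioid Φ B DivB) (ψ : Bo ⟶ A) (h : PreFrobenioid.IsCoAngularPreStep (toElem Φ B DivB) ψ),
      PreFrobenioid.invDiv (toElem Φ B DivB) ψ h.2.2 = x := by
  let x₀ : Φ.obj (op A.base) := x
  let Bo : ModelFrobenioid Φ B DivB := ⟨A.base, A.cls * (Algebra.GrothendieckGroup.of x₀)⁻¹⟩
  let ψ : Bo ⟶ A := mkHom Bo A 1 (𝟙 _) x₀ 1 (by
    show (A.cls * (Algebra.GrothendieckGroup.of x₀)⁻¹) ^ ((1 : ℕ+) : ℕ) * Algebra.GrothendieckGroup.of x₀ =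
      pullGp Φ (𝟙 A.base) A.cls * divB Φ B DivB _ 1
    rw [PNat.one_coe, pow_one, pullGp_id, map_one, mul_one, inv_mul_cancel_right])
  have h : PreFrobenioid.IsCoAngularPreStep (toElem Φ B DivB) ψ :=
    ⟨isCoAngular hBg _, rfl, show IsIso (𝟙 A.base) from inferInstance⟩
  refine ⟨Bo, ψ, h, ?_⟩
  haveI : IsIso (baseMap ψ) := h.2.2
  show pull Φ (inv (𝟙 A.base)) x₀ = x₀
  rw [IsIso.inv_id, pull_id]

end Clauses

end ModelFrobenioid

end Literature.AlgebraicGeometry.Frobenioids
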